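import Summits.MatrixMultiplication.OmegaCensus.DominoLineUnitObstruction
import HarnessLib

/-!
# Unit-test certificates in the quadratic ring `𝔽_q[θ]/(θ² − cθ + 1)` (primes `q ≡ ±1 (mod p)`)

ω-census `pub-omega`, family (b3), seat pub-omega-group gen 26.  Framing: lottery ticket; floor = certified bounds/negative
ranges.  VALUE: the second certificate format of the SHADOW-CONSISTENCY route (`HOME/pub-omega-group-g26/FAMILY-B-ADDENDUM-g26.md`
§3, G2); NOT progress on ω.

`DominoLineUnitObstruction.unitCert` needs a `p`-th root of unity `r` in `ZMod q`, i.e. a prime `q ≡ 1 (mod p)` dividing the real norm of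
`D(a_F) = a² + aā + ā²`.  About half of the non-unit keys only have prime factors `q ≡ −1 (mod p)` (degree-2 primes of `ℚ(ζ_p)`, degree 1 in the
real subfield).  For those the root of unity lives in the quadratic ring `R = (ZMod q)[X]/(X² − cX + 1)` (`c` = the image of `ζ + ζ⁻¹`), which
is a nontrivial commutative ring for every `q > 1`, so `no_line_identity_of_lineD_eq_zero` applies verbatim with `r = θ = X mod (…)`.
The checker does exact pair arithmetic over `ℤ` (`(a, b) ↔ a + bθ`, `θ² = cθ − 1`) and tests divisibility by `q` at the end:

* `mulP`, `powP`, `smulP`, `geomP` (`Σ_{i<p} θ^i`), `levP`/`levcP` (`A = Σ F[i] θ^i`, `B = Σ F[i] θ^{(p−i) mod p}`), `lineDP` (`A² + AB + B²`);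
* `unitCert2 p F q c` (a `Bool`): `1 < q` and `q` divides both coordinates of `geomP c p` and of `lineDP c p F`;
* `unitCert2_sound` (`p ≥ 5`): then no `G, s, K` satisfy the normalised line identity with key `v ↦ F[v.val]`.
The interpretation `ι (a, b) = a + bθ ∈ AdjoinRoot (X² − cX + 1)` is additive and multiplicative (`ι_mulP`), which transports the two checked
congruences to `Σ_{i<p} θ^i = 0` and `lev θ F ^ 2 + lev θ F · levc θ F + levc θ F ^ 2 = 0` in `R`.
-/

namespace Summit.MatrixMultiplication.OmegaCensus

open Finset Polynomial

/-! ## Pair arithmetic (the decide side) -/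

section PairArith

/-- Product in `ℤ[θ]/(θ² − cθ + 1)` on coordinates `(a, b) ↔ a + bθ`. [folklore] -/
def mulP (c : ℤ) (x y : ℤ × ℤ) : ℤ × ℤ :=
  (x.1 * y.1 - x.2 * y.2, x.1 * y.2 + x.2 * y.1 + c * x.2 * y.2)

/-- `θ^n` in pair coordinates. [folklore] -/
def powP (c : ℤ) : ℕ → ℤ × ℤ
  | 0 => (1, 0)
  | n + 1 => mulP c (powP c n) (0, 1)

/-- Integer multiple of a pair. [folklore] -/
def smulP (n : ℤ) (x : ℤ × ℤ) : ℤ × ℤ := (n * x.1, n * x.2)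

/-- `Σ_{i<p} θ^i` in pair coordinates. [folklore] -/
def geomP (c : ℤ) (p : ℕ) : ℤ × ℤ := ∑ i ∈ range p, powP c i

/-- `A = Σ_{i<p} F[i]·θ^i` in pair coordinates. [folklore] -/
def levP (c : ℤ) (p : ℕ) (F : List ℕ) : ℤ × ℤ := ∑ i ∈ range p, smulP (F.getD i 0 : ℕ) (powP c i)

/-- `B = Σ_{i<p} F[i]·θ^{(p − i) mod p}` in pair coordinates. [folklore] -/
def levcP (c : ℤ) (p : ℕ) (F : List ℕ) : ℤ × ℤ := ∑ i ∈ range p, smulP (F.getD i 0 : ℕ) (powP c ((p - i) % p))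

/-- `A² + AB + B²` in pair coordinates. [folklore] -/
def lineDP (c : ℤ) (p : ℕ) (F : List ℕ) : ℤ × ℤ :=
  mulP c (levP c p F) (levP c p F) + mulP c (levP c p F) (levcP c p F) + mulP c (levcP c p F) (levcP c p F)

/-- **Quadratic-ring unit-test certificate** `(q, c)` for the key `F` (list of `p` counts): `1 < q`, and `q` divides both coordinates of
`Σ_{i<p} θ^i` and of `A² + AB + B²` computed in `ℤ[θ]/(θ² − cθ + 1)`. [folklore] -/
def unitCert2 (p : ℕ) (F : List ℕ) (q : ℕ) (c : ℤ) : Bool :=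
  decide (1 < q ∧ (q : ℤ) ∣ (geomP c p).1 ∧ (q : ℤ) ∣ (geomP c p).2 ∧ (q : ℤ) ∣ (lineDP c p F).1 ∧ (q : ℤ) ∣ (lineDP c p F).2)

end PairArith

/-! ## Interpretation in `AdjoinRoot (X² − cX + 1)` over `ZMod q` (the proof side) -/

section Interpretation

variable {q : ℕ} (c : ℤ)

/-- The quadratic polynomial `X² − cX + 1` over `ZMod q`. [folklore] -/
noncomputable def quadPoly (q : ℕ) (c : ℤ) : (ZMod q)[X] := X ^ 2 + (C (-(c : ZMod q)) * X + C 1)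

/-- `X² − cX + 1` is monic. [folklore] -/
theorem quadPoly_monic (q : ℕ) (c : ℤ) : (quadPoly q c).Monic :=
  monic_X_pow_add (degree_linear_lt (a := -(c : ZMod q)) (b := 1))

/-- For `1 < q` the quadratic ring `(ZMod q)[X]/(X² − cX + 1)` is nontrivial. [folklore] -/
theorem nontrivial_adjoinRoot_quadPoly (hq : 1 < q) : Nontrivial (AdjoinRoot (quadPoly q c)) := by
  haveI : Fact (1 < q) := ⟨hq⟩
  rw [AdjoinRoot, Ideal.Quotient.nontrivial_iff, Ne, Ideal.span_singleton_eq_top, (quadPoly_monic q c).isUnit_iff]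
  intro h
  have h2 := congrArg (fun f : (ZMod q)[X] => f.coeff 2) h
  simp only [quadPoly, coeff_add, coeff_X_pow, if_true, coeff_C_mul, coeff_X, coeff_C, coeff_one] at h2
  norm_num at h2

/-- The interpretation `(a, b) ↦ a + bθ`. [folklore] -/
noncomputable def pairEval (θ : AdjoinRoot (quadPoly q c)) : ℤ × ℤ →+ AdjoinRoot (quadPoly q c) where
  toFun x := (x.1 : AdjoinRoot (quadPoly q c)) + (x.2 : AdjoinRoot (quadPoly q c)) * θ
  map_zero' := by simp
  map_add' x y := by
    simp only [Prod.fst_add, Prod.snd_add, Int.cast_add]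
    ring

/-- The root satisfies `θ² = cθ − 1`. [folklore] -/
theorem root_sq : (AdjoinRoot.root (quadPoly q c)) ^ 2 =
    (c : AdjoinRoot (quadPoly q c)) * AdjoinRoot.root (quadPoly q c) - 1 := by
  have h : eval₂ (AdjoinRoot.of (quadPoly q c)) (AdjoinRoot.root (quadPoly q c))
      (X ^ 2 + (C (-(c : ZMod q)) * X + C 1)) = 0 := AdjoinRoot.eval₂_root (quadPoly q c)
  rw [eval₂_add, eval₂_add, eval₂_X_pow, eval₂_mul, eval₂_C, eval₂_X, eval₂_C, map_neg, map_intCast, map_one] at h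
  linear_combination h

/-- `ι` is multiplicative. [folklore] -/
theorem pairEval_mulP (x y : ℤ × ℤ) :
    pairEval c (AdjoinRoot.root (quadPoly q c)) (mulP c x y) =
      pairEval c (AdjoinRoot.root (quadPoly q c)) x * pairEval c (AdjoinRoot.root (quadPoly q c)) y := by
  have h := root_sq (q := q) c
  simp only [pairEval, AddMonoidHom.coe_mk, ZeroHom.coe_mk, mulP, Int.cast_sub, Int.cast_mul, Int.cast_add]
  linear_combination (-(x.2 : AdjoinRoot (quadPoly q c)) * (y.2 : AdjoinRoot (quadPoly q c))) * h

/-- `ι (powP n) = θ^n`. [folklore] -/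
theorem pairEval_powP (n : ℕ) :
    pairEval c (AdjoinRoot.root (quadPoly q c)) (powP c n) = (AdjoinRoot.root (quadPoly q c)) ^ n := by
  induction n with
  | zero => simp [powP, pairEval]
  | succ n ih =>
    rw [powP, pairEval_mulP, ih, pow_succ]
    congr 1
    simp [pairEval]

/-- `ι (smulP n x) = n · ι x`. [folklore] -/
theorem pairEval_smulP (θ : AdjoinRoot (quadPoly q c)) (n : ℤ) (x : ℤ × ℤ) :
    pairEval c θ (smulP n x) = (n : AdjoinRoot (quadPoly q c)) * pairEval c θ x := by
  simp only [pairEval, AddMonoidHom.coe_mk, ZeroHom.coe_mk, smulP, Int.cast_mul]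
  ring

/-- `(q : R) = 0` in the quadratic ring over `ZMod q`. [folklore] -/
theorem natCast_self_adjoinRoot : ((q : ℕ) : AdjoinRoot (quadPoly q c)) = 0 := by
  have h := map_natCast (algebraMap (ZMod q) (AdjoinRoot (quadPoly q c))) q
  rw [ZMod.natCast_self, map_zero] at h
  exact h.symm

/-- A pair with both coordinates divisible by `q` interprets to `0`. [folklore] -/
theorem pairEval_eq_zero_of_dvd (θ : AdjoinRoot (quadPoly q c)) {x : ℤ × ℤ} (h1 : (q : ℤ) ∣ x.1) (h2 : (q : ℤ) ∣ x.2) :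
    pairEval c θ x = 0 := by
  obtain ⟨k1, hk1⟩ := h1
  obtain ⟨k2, hk2⟩ := h2
  simp only [pairEval, AddMonoidHom.coe_mk, ZeroHom.coe_mk, hk1, hk2, Int.cast_mul, Int.cast_natCast,
    natCast_self_adjoinRoot, zero_mul, add_zero]

end Interpretation

/-! ## Soundness -/

section Sound

variable {p : ℕ} [Fact p.Prime]

/-- `lev θ F = ι (levP …)` for the key function `v ↦ F[v.val]`. [folklore] -/
theorem lev_eq_pairEval_levP {q : ℕ} (c : ℤ) (F : List ℕ) :
    lev (AdjoinRoot.root (quadPoly q c)) (fun v : ZMod p => F.getD v.val 0) =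
      pairEval c (AdjoinRoot.root (quadPoly q c)) (levP c p F) := by
  unfold lev levP zch
  rw [map_sum, sum_val_eq_sum_range (fun i => ((F.getD i 0 : ℕ) : AdjoinRoot (quadPoly q c)) *
    (AdjoinRoot.root (quadPoly q c)) ^ i)]
  refine sum_congr rfl fun i _ => ?_
  rw [pairEval_smulP, pairEval_powP, Int.cast_natCast]

/-- `levc θ F = ι (levcP …)`. [folklore] -/
theorem levc_eq_pairEval_levcP {q : ℕ} (c : ℤ) (F : List ℕ) :
    levc (AdjoinRoot.root (quadPoly q c)) (fun v : ZMod p => F.getD v.val 0) =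
      pairEval c (AdjoinRoot.root (quadPoly q c)) (levcP c p F) := by
  haveI : NeZero p := ⟨(Fact.out : p.Prime).ne_zero⟩
  unfold levc levcP zch
  rw [map_sum]
  have e : ∀ v : ZMod p, (-v).val = (p - v.val) % p := fun v => ZMod.neg_val' v
  simp_rw [e]
  rw [sum_val_eq_sum_range (fun i => ((F.getD i 0 : ℕ) : AdjoinRoot (quadPoly q c)) *
    (AdjoinRoot.root (quadPoly q c)) ^ ((p - i) % p))]
  refine sum_congr rfl fun i _ => ?_
  rw [pairEval_smulP, pairEval_powP, Int.cast_natCast]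

/-- **Soundness of the quadratic-ring certificate** (`p ≥ 5`): `unitCert2 p F q c = true` excludes every solution `G, s, K` of the normalised
line identity with key `v ↦ F[v.val]`. [folklore] -/
theorem unitCert2_sound (hp5 : 5 ≤ p) {F : List ℕ} {q : ℕ} {c : ℤ} (h : unitCert2 p F q c = true) (G : ZMod p → ℕ)
    (s : ZMod p) (K : ℕ)
    (hid : ∀ τ : ZMod p, (∑ v : ZMod p, ((fun v : ZMod p => F.getD v.val 0) (τ - v) + (fun v : ZMod p => F.getD v.val 0) (v - τ) +
      (fun v : ZMod p => F.getD v.val 0) (τ + v)) * G v) + (if s = τ then 1 else 0) = K) : False := by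
  obtain ⟨hq, hg1, hg2, hd1, hd2⟩ := of_decide_eq_true h
  haveI := nontrivial_adjoinRoot_quadPoly c hq
  set θ := AdjoinRoot.root (quadPoly q c) with hθ
  -- `Σ_{i<p} θ^i = 0`
  have hr : ∑ i ∈ range p, θ ^ i = 0 := by
    have e : pairEval c θ (geomP c p) = ∑ i ∈ range p, θ ^ i := by
      unfold geomP
      rw [map_sum]
      exact sum_congr rfl fun i _ => by rw [hθ, pairEval_powP]
    rw [← e]
    exact pairEval_eq_zero_of_dvd c θ hg1 hg2
  -- `D = 0`
  have hD : (lev θ (fun v : ZMod p => F.getD v.val 0)) ^ 2 +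
      lev θ (fun v : ZMod p => F.getD v.val 0) * levc θ (fun v : ZMod p => F.getD v.val 0) +
      (levc θ (fun v : ZMod p => F.getD v.val 0)) ^ 2 = 0 := by
    rw [hθ, lev_eq_pairEval_levP, levc_eq_pairEval_levcP, pow_two, pow_two, ← pairEval_mulP, ← pairEval_mulP,
      ← pairEval_mulP, ← map_add, ← map_add]
    exact pairEval_eq_zero_of_dvd c _ hd1 hd2
  exact no_line_identity_of_lineD_eq_zero hp5 hr _ hD G s K hid

/-- Worked instance (`p = 5`): the key `[0,0,0,1,2]` of `unitCert_example` in the pair format: `q = 31`, `c = θ + θ⁻¹ = 2 + 16 = 18`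
(`x² − 18x + 1 ≡ (x − 2)(x − 16) (mod 31)`); at `θ = 2`: `A = 40`, `B = 8`, `A² + AB + B² = 217 = 7·31`, and symmetrically at `θ = 16`. [folklore] -/
theorem unitCert2_example : unitCert2 5 [0,0,0,1,2] 31 18 = true := by
  decide

end Sound

end Summit.MatrixMultiplication.OmegaCensus
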